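import Summits.QuantumFields.BalabanUV.Beta.D1BFx.GhostTwoPointBubbles

/-!
# `BalabanUV.Beta.D1BFx.GhostTwoPointBubbleSum` — road «BF-x» for binder row D1, END-ii row «L-GBUB-ii» PART 3 (the ghost twin of PART II (I3c)
# `TwoPointBubbleSum`): the GRADED TWO-LEG TABLE through two regraded ghost pieces under the moment weight — punctured partial sums converge,
# `|fullSum| ≤ A` with `A` fixed before the scale

HONEST DEPENDENCY (page 1, mandatory): continuum YM on T⁴ ⇐ BetaPertH ∧ nine spine estimates (0/9 proved); BetaPertH ⇐ (D1) ∧ (D4) ∧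
CAP+tail; G-an2-4 gates asym, D1 and NE2/3/4.  HONEST FRAMING (cell contract, verbatim): «discharging `BetaPertH` makes Bałaban's UV
stability UNCONDITIONAL — a real constructive-QFT result; it is NOT the continuum limit and NOT the Clay problem.»  THIS MODULE DISCHARGES
NOTHING of the wall: [folklore] composition BY NAME of PART 2 `GhostTwoPointBubbles.exists_bound_moment_term₂` over the finite term list of (F3b)
`GradedBiBubbleMoving.exists_eterms₂_of_graded_mov` (generic in the fibre; `WindowIdentification.fullSum_add`).  The rows of `n²·Ggh` and of `g` are
HYPOTHESES in the END's shape; no `def`, no `Prop` minted, nothing cited, 0 sorry.  0 wall binders; NOT a row, NOT (K), NOT D1, NOT `BetaPertH`,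
NOT continuum, NOT Clay.

ABSOLUTE RULE (cell charter, verbatim): «No internally-minted statement may enter as a cited fact. Every hypothesis is either kernel-proved in
this package or a verbatim quotation of a PUBLISHED theorem with page reference. The manuscript(s) under audit are NOT citable for their own
disputed steps — they are the thing under adjudication; programme-internal (2001/route/tribunal) claims are never citable.»

WHY (owner d1-p2-g11 RULING ρ-g11-9 ∕ `END-ii-SPEC.md` v1 §3(c); STATEMENT «L-GBUB-ii» `CLAIMS.log` 2026-08-21T15:34:42Z): the END-ii ghost-bubble words at
`τ = inr³ (inl (0,0,r,r′))`, `(r,r′) ≠ (0,0)`, are `4N²·(−½)·w_μw_ν·bub₂ P_r P_r′ (b + w) b (ghostStn μ 1) (ghostStn ν 1)` for the regraded ghost pieces `P_r`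
and an3's once-differenced ghost lists; this file bounds the weighted full sum uniformly in the scale and in `b`; PART 4 instantiates the rows and assembles
the three `hGbub`-ii clauses.
* [folklore] `exists_bound_moment_terms₂` (finite lists), **`exists_bound_fullSum_moment_bub₂`**: `Graded n₁ V → Graded n₂ W → 1 ≤ n₁ → 2 ≤ n₁ + n₂ →
  (r, r') ≠ (0, 0) → ∃ A ≥ 0, ∀ n ≥ 1, ∀ g even, ∀ rows, ∀ b μ ν`, convergence of the punctured partial sums and `|fullSum| ≤ A`.
Unit `b2b-balaban-gan24-formalise-leaf-05` (gen 44), G-an2-4 swarm leaf seat on road «BF-x» at the OWNER's grant (ρ-g11-9 (3)(c)); `LEAVES-BFx.md` row «L-GBUB-ii» PART 3.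
-/

noncomputable section

namespace Summit.QuantumFields.BalabanUV.Beta.D1BFx.GhostTwoPointBubbleSum

open Filter Topology
open Literature.MathematicalPhysics.QuantumFieldTheory.Balaban1983to89.Beta
open ExpKernelCalculus (Site MKer)
open DyadicShell (Pt supNorm toReal)
open BubbleTransfer (unitVec)
open GhostTable (gFree)
open WindowIdentification (psum fullSum fullSum_add fullSum_eq_of_tendsto exists_tendsto_psum_of_summable)
open GradedBubbles (Stn Graded IsStep)
open BiBubbleTable (bub₂)
open GradedBiBubbleTerms (ETerm₂)
open GradedBiBubbleMoving (exists_eterms₂_of_graded_mov)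
open GhostTwoPointBubbles (exists_bound_moment_term₂)
open Summit.QuantumFields.BalabanUV.Beta.D1BFx.GhostLeg (Ggh)
open Summit.QuantumFields.BalabanUV.Beta.D1BFx.FineHessianGhostGrades (ghLeg)

variable {a δ A₀ A₁ D₀ D₁ : ℝ}

/-- [folklore] **A FINITE LIST OF TWO-POINT TERMS** (each with unit steps, `2 ≤ len`, a moving step) through `P_r`, `P_r′`, `(r, r') ≠ (0, 0)`:
ONE bound, fixed before the scale, for the full sum of the weighted list sum (induction on the list, `fullSum_add`). -/
theorem exists_bound_moment_terms₂ (Lst : List (ETerm₂ Unit))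
    (hL : ∀ t ∈ Lst, (∀ e ∈ t.sA ++ t.dA ++ t.dB ++ t.sB, IsStep e) ∧ 2 ≤ t.len ∧ 1 ≤ t.dA.length + t.dB.length)
    (r r' : Fin 2) (hrr : ¬(r = 0 ∧ r' = 0)) (ha : 0 < a) (hδ : 0 < δ) (hA₀ : 0 ≤ A₀) (hA₁ : 0 ≤ A₁) (hD₀ : 0 ≤ D₀) (hD₁ : 0 ≤ D₁) :
    ∃ A : ℝ, 0 ≤ A ∧ ∀ (n : ℕ) [NeZero n], 1 ≤ n → ∀ (g : Pt → ℝ), (∀ w, g (-w) = g w) →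
      (∀ (b v : Pt), v ≠ 0 → |(n : ℝ) ^ 2 * Ggh n a (b + v) b () ()| ≤ A₀ * Real.exp (-(δ / n) * supNorm v) / (supNorm v : ℝ) ^ 2) →
      (∀ (b v : Pt), v ≠ 0 → ∀ ρ : Fin 4, |(n : ℝ) ^ 2 * Ggh n a (b + (v + unitVec ρ)) b () () - (n : ℝ) ^ 2 * Ggh n a (b + v) b () ()| ≤
        A₁ * Real.exp (-(δ / n) * supNorm v) / (supNorm v : ℝ) ^ 3) →
      (∀ v : Pt, v ≠ 0 → |g v| ≤ A₀ * Real.exp (-(δ / n) * supNorm v) / (supNorm v : ℝ) ^ 2) →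
      (∀ v : Pt, v ≠ 0 → ∀ ρ : Fin 4, |g (v + unitVec ρ) - g v| ≤ A₁ * Real.exp (-(δ / n) * supNorm v) / (supNorm v : ℝ) ^ 3) →
      (∀ v : Pt, |g v - gFree v| ≤ D₀ / (n : ℝ) ^ 2) →
      (∀ (v : Pt) (ρ : Fin 4), |(g (v + unitVec ρ) - gFree (v + unitVec ρ)) - (g v - gFree v)| ≤ D₁ / (n : ℝ) ^ 3) →
      ∀ (b : Pt) (μ ν : Fin 4),
        Summable (fun w : Pt => (Lst.map fun t => toReal w μ * toReal w ν * t.eval ((n : ℝ) ^ 2 • ghLeg n a (fun v => ((n : ℝ) ^ 2)⁻¹ * g v) r) ((n : ℝ) ^ 2 • ghLeg n a (fun v => ((n : ℝ) ^ 2)⁻¹ * g v) r') (b + w) b).sum) ∧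
        |fullSum (fun w : Pt => (Lst.map fun t => toReal w μ * toReal w ν * t.eval ((n : ℝ) ^ 2 • ghLeg n a (fun v => ((n : ℝ) ^ 2)⁻¹ * g v) r) ((n : ℝ) ^ 2 • ghLeg n a (fun v => ((n : ℝ) ^ 2)⁻¹ * g v) r') (b + w) b).sum)| ≤ A := by
  induction Lst with
  | nil =>
      refine ⟨0, le_rfl, fun n _ hn g hg e0 e1 d0 d1 h0 h1 b μ ν => ?_⟩
      simp only [List.map_nil, List.sum_nil]
      refine ⟨summable_zero, ?_⟩
      have hz : fullSum (fun _ : Pt => (0 : ℝ)) = 0 := by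
        refine fullSum_eq_of_tendsto ?_
        have : psum (fun _ : Pt => (0 : ℝ)) = fun _ => 0 := by funext R; simp [psum]
        rw [this]; exact tendsto_const_nhds
      rw [hz, abs_zero]
  | cons t Lst ih =>
      obtain ⟨A, hA, hrest⟩ := ih (fun t' ht' => hL t' (List.mem_cons_of_mem t ht'))
      obtain ⟨B, hB, hterm⟩ := exists_bound_moment_term₂ t (hL t (by simp)).1 (hL t (by simp)).2.1 (hL t (by simp)).2.2 r r' hrr ha hδ hA₀ hA₁ hD₀ hD₁
      refine ⟨B + A, by positivity, fun n _ hn g hg e0 e1 d0 d1 h0 h1 b μ ν => ?_⟩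
      obtain ⟨hs₁, hb₁⟩ := hterm n hn g hg e0 e1 d0 d1 h0 h1 b μ ν
      obtain ⟨hs₂, hb₂⟩ := hrest n hn g hg e0 e1 d0 d1 h0 h1 b μ ν
      simp only [List.map_cons, List.sum_cons]
      refine ⟨hs₁.add hs₂, ?_⟩
      rw [fullSum_add (exists_tendsto_psum_of_summable _ hs₁) (exists_tendsto_psum_of_summable _ hs₂)]
      exact (abs_add_le _ _).trans (add_le_add hb₁ hb₂)

/-- [folklore] **PART 3's HEADLINE.**  For graded stencils `Graded n₁ V`, `Graded n₂ W` on the ghost fibre `Unit` with `1 ≤ n₁`, `2 ≤ n₁ + n₂`, regraded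
pieces `(r, r') ≠ (0, 0)`, and row constants `a > 0`, `δ > 0`, `A₀, A₁, D₀, D₁ ≥ 0`: ONE `A ≥ 0` such that for every scale `n ≥ 1`, every even profile `g`
and regraded ghost leg `n²·Ggh` obeying at scale `n` the far rows d0∕d1 (both) and the window rows h0∕h1 (of `g`), every base point `b` and every `μ, ν`, the
punctured partial sums of `w ↦ w_μw_ν·bub₂ P_r P_r′ (b + w) b V W` converge and `|fullSum| ≤ A` (uniformly in `n` and `b`). -/
theorem exists_bound_fullSum_moment_bub₂ {n₁ n₂ : ℕ} {V W : Stn Unit} (hV : Graded n₁ V) (hW : Graded n₂ W) (hn₁ : 1 ≤ n₁) (hn₂ : 2 ≤ n₁ + n₂)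
    (r r' : Fin 2) (hrr : ¬(r = 0 ∧ r' = 0)) (ha : 0 < a) (hδ : 0 < δ) (hA₀ : 0 ≤ A₀) (hA₁ : 0 ≤ A₁) (hD₀ : 0 ≤ D₀) (hD₁ : 0 ≤ D₁) :
    ∃ A : ℝ, 0 ≤ A ∧ ∀ (n : ℕ) [NeZero n], 1 ≤ n → ∀ (g : Pt → ℝ), (∀ w, g (-w) = g w) →
      (∀ (b v : Pt), v ≠ 0 → |(n : ℝ) ^ 2 * Ggh n a (b + v) b () ()| ≤ A₀ * Real.exp (-(δ / n) * supNorm v) / (supNorm v : ℝ) ^ 2) →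
      (∀ (b v : Pt), v ≠ 0 → ∀ ρ : Fin 4, |(n : ℝ) ^ 2 * Ggh n a (b + (v + unitVec ρ)) b () () - (n : ℝ) ^ 2 * Ggh n a (b + v) b () ()| ≤
        A₁ * Real.exp (-(δ / n) * supNorm v) / (supNorm v : ℝ) ^ 3) →
      (∀ v : Pt, v ≠ 0 → |g v| ≤ A₀ * Real.exp (-(δ / n) * supNorm v) / (supNorm v : ℝ) ^ 2) →
      (∀ v : Pt, v ≠ 0 → ∀ ρ : Fin 4, |g (v + unitVec ρ) - g v| ≤ A₁ * Real.exp (-(δ / n) * supNorm v) / (supNorm v : ℝ) ^ 3) →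
      (∀ v : Pt, |g v - gFree v| ≤ D₀ / (n : ℝ) ^ 2) →
      (∀ (v : Pt) (ρ : Fin 4), |(g (v + unitVec ρ) - gFree (v + unitVec ρ)) - (g v - gFree v)| ≤ D₁ / (n : ℝ) ^ 3) →
      ∀ (b : Pt) (μ ν : Fin 4),
        (∃ B : ℝ, Tendsto (psum (fun w : Pt => toReal w μ * toReal w ν * bub₂ ((n : ℝ) ^ 2 • ghLeg n a (fun v => ((n : ℝ) ^ 2)⁻¹ * g v) r) ((n : ℝ) ^ 2 • ghLeg n a (fun v => ((n : ℝ) ^ 2)⁻¹ * g v) r') (b + w) b V W)) atTop (𝓝 B)) ∧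
        |fullSum (fun w : Pt => toReal w μ * toReal w ν * bub₂ ((n : ℝ) ^ 2 • ghLeg n a (fun v => ((n : ℝ) ^ 2)⁻¹ * g v) r) ((n : ℝ) ^ 2 • ghLeg n a (fun v => ((n : ℝ) ^ 2)⁻¹ * g v) r') (b + w) b V W)| ≤ A := by
  obtain ⟨Lst, hL, hid⟩ := exists_eterms₂_of_graded_mov hV hW
  have hL' : ∀ t ∈ Lst, (∀ e ∈ t.sA ++ t.dA ++ t.dB ++ t.sB, IsStep e) ∧ 2 ≤ t.len ∧ 1 ≤ t.dA.length + t.dB.length := fun t ht =>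
    ⟨(hL t ht).1, le_trans hn₂ (hL t ht).2.1, le_trans hn₁ (hL t ht).2.2⟩
  obtain ⟨A, hA, h⟩ := exists_bound_moment_terms₂ Lst hL' r r' hrr ha hδ hA₀ hA₁ hD₀ hD₁
  refine ⟨A, hA, fun n _ hn g hg e0 e1 d0 d1 h0 h1 b μ ν => ?_⟩
  have e : (fun w : Pt => toReal w μ * toReal w ν * bub₂ ((n : ℝ) ^ 2 • ghLeg n a (fun v => ((n : ℝ) ^ 2)⁻¹ * g v) r) ((n : ℝ) ^ 2 • ghLeg n a (fun v => ((n : ℝ) ^ 2)⁻¹ * g v) r') (b + w) b V W) =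
      fun w : Pt => (Lst.map fun t => toReal w μ * toReal w ν * t.eval ((n : ℝ) ^ 2 • ghLeg n a (fun v => ((n : ℝ) ^ 2)⁻¹ * g v) r) ((n : ℝ) ^ 2 • ghLeg n a (fun v => ((n : ℝ) ^ 2)⁻¹ * g v) r') (b + w) b).sum := by
    funext w
    rw [hid ((n : ℝ) ^ 2 • ghLeg n a (fun v => ((n : ℝ) ^ 2)⁻¹ * g v) r) ((n : ℝ) ^ 2 • ghLeg n a (fun v => ((n : ℝ) ^ 2)⁻¹ * g v) r') (b + w) b, ← List.sum_map_mul_left]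
  obtain ⟨hs, hb⟩ := h n hn g hg e0 e1 d0 d1 h0 h1 b μ ν
  rw [e]
  exact ⟨exists_tendsto_psum_of_summable _ hs, hb⟩

end Summit.QuantumFields.BalabanUV.Beta.D1BFx.GhostTwoPointBubbleSum

end
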